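import Literature.NumberTheory.GaloisRepresentations.ContinuousCorestrictionResNormal
import Literature.NumberTheory.GaloisRepresentations.ConjugationDescent
import HarnessLib

/-!
# K6 crux `MuTransferX9` (stmt-BirchSwinnertonDyer-19276), conditional surface F2 (aside 19844),
# input of step (b1) of «Lemma 8.5 (2) on the pin»: the RELATIVE norm `res_{U→N} ∘ cor_{N→U}` on
# continuous `H¹(N, X)` as a `range`-sum over the POWERS of one element `σ ∈ U` generating `U/N`,
# and the resulting determinism / periodicity of the sequence `i ↦ (further restriction of) σ^i · ξ`

Cell `bsd-smallim`, seat `bsd-smallim-k6-g3` (gen 2).  THEOREMS ONLY (no definition, no named fact, no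
`sorry`); generic continuous group cohomology (`X : TopRep R G`, `N ⊴ G` open, `N ≤ U ≤ G`), curve-free.
HONEST FRAMING: TOOL helper toward crux 19276 (conditional surface F2 via aside 19844
`KatoReductionModPKernel`); closes nothing.  PARTITION (D-0054): X9 (A4) × p ∈ {5,7}
(+ X10b∧¬Surj at 3) — helper; closes NONE.  Relative companion of this seat's g0
`KolyvaginTwist.sum_conjMap_pow_eq_resSubgroup_cores` (p451028; absolute `res ∘ cor`), built on
bsd-potss's `resLe_coresLe_eq_sum_conjMap` (normal case of the double-coset formula for the relative
corestriction `coresLe`).  Consumer: lur-a g2's `UniversalNorms.mem_integralH1_of_layerCores_eq_of_smul_mem`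
(STATUS l.379) step (b1): `U = Γ_{n'}`, `N = Γ_m`, `σ = φ'` a Frobenius of depth exactly `n'`
(`(φ')^i`, `i < p^{m−n'}`, represent `Γ_{n'}/Γ_m`), so that
`res_{Γ_m} z_{n'} = res (cor z_m) = Σ_{i<p^k} (φ')^i · z_m` and, after restriction to `Γ_m ⊓ I_𝔓`, the
summands form the deterministic `p^k`-periodic sequence fed to
`UniversalNorms.sum_range_prime_pow_eq_zero_of_periodic` (p478340).

* `sum_range_conjMap_pow_eq_resLe_coresLe` — for `σ ∈ U` whose powers `σ^i`, `i < n`, form a system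
  of representatives of `U/N` (`hcov`, `hinj`): `Σ_{i<n} σ^i · ξ = res_{U→N} (cor_{N→U} ξ)`.
* `conjMap_pow_add_of_pow_mem` — if `σ^n ∈ N` then `σ^{i+n} · ξ = σ^i · ξ` on `H¹(N, X)` (the sequence
  `i ↦ σ^i · ξ` is `n`-periodic; `conjMap_conjMap` + `conjMap_eq_self_of_mem_one`).
* `map_conjMap_pow_succ_eq_of_eq` — for ANY additive map `r` out of `H¹(N, X)` with
  `r y = 0 → r (σ · y) = 0` (e.g. the restriction to `N ⊓ I` for `σ` normalising `I`:
  b2b `resLe_conjMap_eq_zero`), the sequence `i ↦ r (σ^i · ξ)` is DETERMINISTIC: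
  `r (σ^i · ξ) = r (σ^j · ξ) → r (σ^{i+1} · ξ) = r (σ^{j+1} · ξ)`.

References: J. Neukirch, A. Schmidt, K. Wingberg, *Cohomology of Number Fields* (2008) I §5
(1.5.6)–(1.5.7) [NeukirchSchmidtWingberg2008]; J.-P. Serre, *Local Fields* (1979) VII §5 Prop. 3
[SerreLocalFields1979]; K. Kato, Astérisque 295 (2004) Lemma 8.5 (2) [Kato2004Asterisque].
-/

-- the summit and its single problem are both named `BirchSwinnertonDyer` (registry layout D-0017)
set_option linter.dupNamespace false
set_option autoImplicit false

noncomputable section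

open CategoryTheory Finset
open Literature.NumberTheory.GaloisRepresentations

universe u v

namespace Summit.BirchSwinnertonDyer.BirchSwinnertonDyer.Rank1Residual.UniversalNorms

variable {R : Type u} [CommRing R] [TopologicalSpace R]
variable {G : Type v} [Group G] [TopologicalSpace G] [IsTopologicalGroup G]
variable (X : TopRep.{v} R G) {N U : Subgroup G} [N.Normal]

/-- **`Σ_{i<n} σ^i· = res_{U→N} ∘ cor_{N→U}` on `H¹(N, X)`** when the powers `σ^i` (`i < n`) of one
`σ ∈ U` form a system of representatives of `U ⧸ N` (`hcov`: every coset of `U/N` is some `σ^i N`;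
`hinj`: at most once) — bsd-potss's `resLe_coresLe_eq_sum_conjMap` along the transversal `i ↦ σ^i`.
With `U = Γ_{n'}`, `N = Γ_m`, `σ` of depth exactly `n'`, `n = p^{m−n'}`: the relative norm of the
cyclotomic layer `ℚ_m/ℚ_{n'}` as a sum over Frobenius powers.
[cite: NeukirchSchmidtWingberg2008, I §5 (1.5.6)–(1.5.7)] -/
theorem sum_range_conjMap_pow_eq_resLe_coresLe (h : N ≤ U) (hN : IsOpen (N : Set G))
    [Fintype (U ⧸ N.subgroupOf U)] {σ : U} {n : ℕ}
    (hcov : ∀ g : U, ∃ i < n, (σ ^ i)⁻¹ * g ∈ N.subgroupOf U)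
    (hinj : ∀ i₁ < n, ∀ i₂ < n, (σ ^ i₁)⁻¹ * σ ^ i₂ ∈ N.subgroupOf U → i₁ = i₂)
    (ξ : continuousCohomology 1 (subgroupRep X N)) :
    ∑ i ∈ range n, conjMap X N ((σ : G) ^ i) 1 ξ = resLe X h 1 (coresLe X h hN ξ) := by
  classical
  -- the transversal `i ↦ σ^i` of `U ⧸ N`
  let e : Fin n → U ⧸ N.subgroupOf U := fun i => QuotientGroup.mk (σ ^ (i : ℕ))
  have he_inj : Function.Injective e := by
    intro i₁ i₂ h12
    exact Fin.ext (hinj i₁ i₁.2 i₂ i₂.2 (QuotientGroup.eq.mp h12))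
  have he_surj : Function.Surjective e := by
    intro x
    obtain ⟨g, rfl⟩ := QuotientGroup.mk_surjective x
    obtain ⟨i, hi, hig⟩ := hcov g
    exact ⟨⟨i, hi⟩, QuotientGroup.eq.mpr hig⟩
  let eE : Fin n ≃ U ⧸ N.subgroupOf U := Equiv.ofBijective e ⟨he_inj, he_surj⟩
  let s : U ⧸ N.subgroupOf U → U := fun x => σ ^ ((eE.symm x : Fin n) : ℕ)
  have hs : ∀ x, (s x : U ⧸ N.subgroupOf U) = x := fun x => by
    change e (eE.symm x) = x
    exact eE.apply_symm_apply x
  rw [resLe_coresLe_eq_sum_conjMap X h hN hs ξ,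
    ← Fin.sum_univ_eq_sum_range (fun i => conjMap X N ((σ : G) ^ i) 1 ξ), ← eE.sum_comp]
  refine sum_congr rfl fun i _ => ?_
  change conjMap X N ((σ : G) ^ (i : ℕ)) 1 ξ =
    conjMap X N ((σ ^ ((eE.symm (eE i) : Fin n) : ℕ) : U) : G) 1 ξ
  rw [Equiv.symm_apply_apply, Subgroup.coe_pow]

/-- **Periodicity**: if `σ^n ∈ N` then `σ^{i+n} · ξ = σ^i · ξ` on `H¹(N, X)` — elements of `N` act
trivially on `H¹(N, X)` (`conjMap_eq_self_of_mem_one`). [cite: SerreLocalFields1979, VII §5 Prop. 3] -/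
theorem conjMap_pow_add_of_pow_mem {σ : G} {n : ℕ} (hσn : σ ^ n ∈ N)
    (ξ : continuousCohomology 1 (subgroupRep X N)) (i : ℕ) :
    conjMap X N (σ ^ (i + n)) 1 ξ = conjMap X N (σ ^ i) 1 ξ := by
  rw [pow_add, ← conjMap_conjMap X N (σ ^ n) (σ ^ i), conjMap_eq_self_of_mem_one X N hσn]

/-- **Determinism**: for any additive map `r` out of `H¹(N, X)` such that `r y = 0 → r (σ · y) = 0`
(e.g. the restriction to `N ⊓ I` when `σ` normalises `I`), the sequence `i ↦ r (σ^i · ξ)` is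
deterministic: equal terms have equal successors. [cite: SerreLocalFields1979, VII §5 Prop. 3] -/
theorem map_conjMap_pow_succ_eq_of_eq {M : Type*} [AddCommGroup M]
    (r : continuousCohomology 1 (subgroupRep X N) →+ M) {σ : G}
    (hr : ∀ y : continuousCohomology 1 (subgroupRep X N), r y = 0 → r (conjMap X N σ 1 y) = 0)
    (ξ : continuousCohomology 1 (subgroupRep X N)) {i j : ℕ}
    (hij : r (conjMap X N (σ ^ i) 1 ξ) = r (conjMap X N (σ ^ j) 1 ξ)) :
    r (conjMap X N (σ ^ (i + 1)) 1 ξ) = r (conjMap X N (σ ^ (j + 1)) 1 ξ) := by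
  have h0 : r (conjMap X N (σ ^ i) 1 ξ - conjMap X N (σ ^ j) 1 ξ) = 0 := by
    rw [map_sub, hij, sub_self]
  have h1 := hr _ h0
  rw [map_sub, map_sub, conjMap_conjMap X N (σ ^ i) σ, conjMap_conjMap X N (σ ^ j) σ, ← pow_succ',
    ← pow_succ', sub_eq_zero] at h1
  exact h1

end Summit.BirchSwinnertonDyer.BirchSwinnertonDyer.Rank1Residual.UniversalNorms

end
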